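import Summits.HodgeConjecture.HodgeConjecture.Theses.QbarEnvelope
import Summits.HodgeConjecture.HodgeConjecture.Theses.LinearSystemTorelli
import Summits.HodgeConjecture.HodgeConjecture.Theorems.LinearSystemTorelliMiddleDivisorSupportFourfoldStubDominantEnvelope
import Summits.HodgeConjecture.HodgeConjecture.Theorems.LinearSystemTorelliMiddleDivisorSupportFourfoldStubFiniteMonodromyOfTypeStability
import Literature.AlgebraicGeometry.HodgeTheory.ContinuationLoopsZariskiOpen
import Literature.AlgebraicGeometry.HodgeTheory.AlgebraicCyclesDefinedOverQbarSpread
import Literature.AlgebraicGeometry.HodgeTheory.HodgeConjectureQbarVoisin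
import Literature.AlgebraicGeometry.FundamentalGroup.RiemannExistenceQbarDescentProofs
import Literature.AlgebraicGeometry.FundamentalGroup.RiemannExistenceSeparatingLowDim

/-!
# Birth skeleton (BC3) of the crux `Envelope` — Voisin's `ℚ̄`-funnel, all `(n, p)`, cut at its four inputs

Crux `stmt-HodgeConjecture-1069` of route `QbarEnvelope` (rank 2, the transcendence content of the
thesis `X = Envelope ∧ HCOverNumberFields`):

  `Envelope := ∀ n X, IsSmoothProjective n X → ∀ p (c : complexBetti X (2*p)), IsRationalClass c →
     IsOfHodgeType n X (2*p) p p c → ∃ m W (ι : X ⟶ W) c', IsSmoothProjective m W ∧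
     (∃ K [NumberField K] (σ : K →+* ℂ) W₀, Nonempty (W ≅ W₀ ⊗_{K,σ} ℂ)) ∧ IsRationalClass c' ∧
     IsOfHodgeType m W (2*p) p p c' ∧ ι^* c' = c`

— every rational `(p,p)` class on a smooth projective complex variety is the pull-back of a rational
`(p,p)` class on a smooth projective variety DEFINABLE OVER A NUMBER FIELD (the real-carrier OUTPUT
of Voisin 2007, Prop. 1.7 = Charles–Schnell, Thm. 11.3.19). Registrar skeleton (`skeleton-register`,
planner one-shot), cut along the road the tree has ALREADY kernel-checked for the sister crux
stmt-2409 (`LinearSystemTorelli.MiddleDivisorSupportFourfold`, line `IdeatorFiveSketch`, v18), whose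
`ℚ̄`-spelled dominant form of this very statement is the tree's
`Theorems.linearSystemTorelli_dominantQbarEnvelope_of_qbarGenericIsHodgeGeneric` (all `(n,p)`,
p119707; evidence note on stmt-1069 by lead c3: "gap to stmt-1069 verbatim = `ℚ̄ →` number-field
descent (EGA IV 8)"). Spread `X` out over `ℚ̄` (`spreadingOut_smoothProjective_qbarFamily_holds`,
PROVED: `e : X ≅ 𝒳_s`, `s` over the generic point of a smooth irreducible quasi-projective `ℚ̄`-base),
then:

* `stub_typeStabilityAtQbarGenericZariskiLocal` — T, THE TRANSCENDENCE KERNEL (OPEN), all `(n,p)`: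
  at a point `s` over the generic point of a smooth projective `ℚ̄`-family, for every rational
  `(p,p)` class `α` on `𝒳_s` there is a proper `ℚ̄`-closed `Z₀ ⊊ S₀` such that the flat
  continuations of `α` along loops at `s` avoiding `Z₀` are of type `(p,p)` ("the Hodge-locus
  component through `(s, α)` is defined over `ℚ̄`, hence has dense image": Voisin 2007's question /
  Thm. 0.5 (2); known in positive period dimension and level `≥ 3`, Klingler–Otwinowska–Urbanik 2023
  Thm. 1.12, Baldi–Klingler–Ullmo 2024; implied by HC). Verbatim the `(n,p)`-general form of the
  sister line's registered kernel A'' (there `(4,2)`). It gives GLOBAL type stability by the tree's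
  loop-shrinking theorem `IsContinuationAlong.exists_loop_forall_base_pt_notMem_of_qbarFamily`
  (p136872) and then FINITE MONODROMY by the tree's unconditional
  `Theorems.linearSystemTorelli_finite_setOf_isContinuationAlong_of_forall_isOfHodgeType` (Hodge–Riemann
  for the relative hyperplane class + lattice finiteness; Cattani–Deligne–Kaplan §1, BKU §3.2).
* `stub_locallyAlgebraicSeparatingSmoothAffineDimGeTwo` — C, the Zariski-local smooth-affine
  separating-function residual of RIEMANN'S EXISTENCE THEOREM in relative dimension `≥ 2` (SGA1 XII
  Thm. 5.1, proof part 2; classical, unformalised): VERBATIM the sister line's registered stub C1'''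
  (one proof closes both). It yields the named fact
  `FundamentalGroup.riemannExistence_qbarDescent_of_finiteIndex` by the tree's
  `…_of_locallyAlgebraicSeparating` (Theorems A/B′, Zariski-local gluing, weak `ℚ̄`-descent — PROVED)
  and the PROVED relative dimension `≤ 1` (`algebraicSeparating_of_smoothOfRelativeDimension_le_one`).
* `stub_deligneGlobalInvariantCycles` — D, DELIGNE'S THÉORÈME DE LA PARTIE FIXE (Hodge II Thm. 4.1.1;
  classical, unformalised) as the EXISTING route item stmt-HodgeConjecture-16363
  `Theses.LinearSystemTorelli.DeligneGlobalInvariantCycles` BY NAME (`Iff.rfl` with the named fact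
  `deligne_globalInvariantCycles`; closes by `exact Theses.LinearSystemTorelli.DeligneGlobalInvariantCycles_holds`
  the moment that item closes).
* `stub_numberFieldModel` — N, NUMBER-FIELD DESCENT (EGA IV₃ 8.8.2 (ii) / Görtz–Wedhorn Thm. 10.66;
  classical, M-sized in the tree): a smooth projective `ℚ̄`-scheme has a model over a number field,
  `W₀ ≅ W₁ ⊗_{K,ι} ℚ̄`. Road in the tree: `Limits.exists_isPullback_specMap_subalgebra` (`K = ℚ`,
  `B = ℚ̄`: a model over a finitely generated `ℚ`-subalgebra `R ⊆ ℚ̄`, PROVED), `R` is a field finite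
  over `ℚ` (integral domain, finitely generated and algebraic over `ℚ`), i.e. a number field.
  This is exactly the "gap to stmt-1069 verbatim" recorded on the item.
* B, the TRANSFER MECHANISM, is NOT a stub: it is the tree's PROVED
  `Theorems.stub_dominantEnvelopeOfFiniteMonodromy` (p119525; Voisin 2007 §3 / Charles–Schnell
  Thm. 11.3.19: a finite-monodromy class at a `ℚ̄`-generic point is `ι^* c'` for a rational `(p,p)`
  class `c'` on a smooth projective `W₀ ⊗_σ ℂ`, `W₀` over `ℚ̄`), with antecedents exactly C and D.
* `Envelope_of` (no `sorry`): T → C → D → N → `Theses.QbarEnvelope.Envelope`, concluded BY NAME: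
  fix `σ : ℚ̄ →+* ℂ` (`exists_ringHom_algebraicClosure_rat_complex`), spread, finite monodromy from T,
  dominant `ℚ̄`-envelope from B(C, D), descend `W₀` to smooth projective over `ℚ̄`
  (`isSmoothProjective_of_baseChangeHom`, PROVED), take the number-field model (N) and compose the
  base changes (`Over.pullbackComp`).

`sorry` occurs only inside the four `stub_*` theorems. No stub is cheaply the crux or the summit
(BC3 probes in the registrar's folder `bc/`, raw outputs in its NOTES.md): T lacks B's inputs and the
descent, C/D/N are classical theorems that say nothing about Hodge classes on their own.
Disproof used: none relevant (no `Cruxes/Envelope/Disproof.lean`, `ledger crux ls` empty; negatives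
index of the summit has no statement about envelopes / fields of definition).
-/

set_option linter.dupNamespace false

namespace Summit.HodgeConjecture.HodgeConjecture.Cruxes.Envelope.Birth

open CategoryTheory AlgebraicGeometry Topology
open Literature.AlgebraicGeometry Literature.AlgebraicGeometry.Motives
open Literature.AlgebraicGeometry.HodgeTheory
open Literature.AlgebraicTopology.SingularHomology

/-! ### The registered stubs -/

/-- **T — type stability at `ℚ̄`-generic points, Zariski-locally on the base (TRANSCENDENCE KERNEL,
OPEN), all `(n, p)`.** For `σ : ℚ̄ →+* ℂ`, a `ℚ̄`-morphism `f₀ : 𝒳₀ ⟶ S₀` of quasi-projective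
`ℚ̄`-schemes with `S₀` smooth irreducible whose complexification is a smooth projective family of
relative dimension `n`, a complex point `s` over the GENERIC point of `S₀` and a rational `(p,p)`
class `α` on `𝒳_s`: there is a proper Zariski-closed `Z₀ ⊊ S₀` such that every flat continuation `β`
of `α` along a loop at `s` all of whose points lie over `S₀ ∖ Z₀` is again of type `(p,p)` (the
Hodge-locus component through `(s, α)` has dense, `ℚ̄`-constructible image in `S₀`). The
`(n,p)`-general form of the registered kernel A'' of `Cruxes/MiddleDivisorSupportFourfold/Lines/IdeatorFiveSketch.lean`.
Why it might fail: a Hodge-locus component of a `ℚ`-family through a `ℚ̄`-generic point that is NOT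
defined over `ℚ̄` (then HC fails too, Voisin 2007 §0); known for weakly non-factor components of
positive period dimension (KOU 2023 Thm. 1.12) — the dark case is an isolated point of the Hodge
locus. [Voisin2007HodgeLoci Thm. 0.5 (2), Prop. 1.7; CharlesSchnell2014Notes Thm. 11.3.17–11.3.19;
KlinglerOtwinowskaUrbanik2023 Thm. 1.12; BaldiKlinglerUllmo2024 §3.2; CattaniDeligneKaplan1995JAMS] -/
theorem stub_typeStabilityAtQbarGenericZariskiLocal :
    ∀ (σ : AlgebraicClosure ℚ →+* ℂ) ⦃𝒳₀ S₀ : SchemeOver (AlgebraicClosure ℚ)⦄ (f₀ : 𝒳₀ ⟶ S₀)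
      (n p : ℕ), IsQuasiProjectiveOver 𝒳₀ → IsQuasiProjectiveOver S₀ → IrreducibleSpace S₀.left →
      AlgebraicGeometry.Smooth S₀.hom → IsSmoothProjectiveFamily ((baseChangeHom σ).map f₀) n →
      ∀ (s : ComplexPoints ((baseChangeHom σ).obj S₀)),
        closure {(baseChangeHomFst σ S₀).base s.pt} = (Set.univ : Set S₀.left) →
        ∀ (α : complexBetti (fiberOver ((baseChangeHom σ).map f₀) s) (2 * p)),
          IsRationalClass α → IsOfHodgeType n (fiberOver ((baseChangeHom σ).map f₀) s) (2 * p) p p α →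
          ∃ Z₀ : Set S₀.left, IsClosed Z₀ ∧ Z₀ ≠ Set.univ ∧
            ∀ (γ : Path s s), (∀ u, (baseChangeHomFst σ S₀).base (γ u).pt ∉ Z₀) →
              ∀ (β : complexBetti (fiberOver ((baseChangeHom σ).map f₀) s) (2 * p)),
                IsContinuationAlong γ α β →
                  IsOfHodgeType n (fiberOver ((baseChangeHom σ).map f₀) s) (2 * p) p p β := by
  sorry

/-- **C — locally algebraic separating functions on finite coverings of smooth irreducible affine
`ℂ`-schemes of relative dimension `≥ 2` (the open residual of RIEMANN'S EXISTENCE THEOREM in the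
tree; classical).** For every smooth irreducible AFFINE `ℂ`-scheme `S` of relative dimension
`n + 2`, every covering map `q : T → S(ℂ)` with finite fibres and every `P₀ ∈ S(ℂ)`, there are an
affine open `U ∋ P₀` of `S`, a function `h : T → ℂ` continuous on `q⁻¹(U(ℂ))` and injective on
`q⁻¹(P₀)`, and a NON-ZERO `F ∈ Γ(S, U)[τ]` with `F(q t)(h t) = 0` whenever `q t ∈ U(ℂ)` — VERBATIM
the registered stub C1''' of the sister line (stmt-2409, `IdeatorFiveSketch` v18), i.e. the
hypothesis of the tree's `FundamentalGroup.riemannExistence_qbarDescent_of_finiteIndex_of_locallyAlgebraicSeparating`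
restricted to relative dimension `≥ 2` (dimension `≤ 1` is PROVED:
`FundamentalGroup.algebraicSeparating_of_smoothOfRelativeDimension_le_one`). Why it might fail:
only by mis-typing — it is SGA1 XII Thm. 5.1 (Grauert–Remmert / GAGA / Hörmander `L²` in étale
coordinates); the risk is size ("dimension `≥ 2`: theories absent", fact seat 2026-08-17).
[SGA1 Exp. XII Thm. 5.1 (p. 333), proof, part 2; GrauertRemmert1958; SerreGAGA1956] -/
theorem stub_locallyAlgebraicSeparatingSmoothAffineDimGeTwo :
    ∀ (n : ℕ) (S : SchemeOver ℂ), IsAffine S.left → SmoothOfRelativeDimension (n + 2) S.hom →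
      IrreducibleSpace S.left →
      ∀ (T : Type) [TopologicalSpace T] (q : T → ComplexPoints S) (_ : IsCoveringMap q)
        (_ : ∀ t, (q ⁻¹' {t}).Finite) (P₀ : ComplexPoints S),
        ∃ (U : S.left.Opens) (_ : IsAffineOpen U) (_ : P₀.pt ∈ U) (h : T → ℂ)
          (F : Polynomial Γ(S.left, U)),
          ContinuousOn h (q ⁻¹' {P | P.pt ∈ U}) ∧ F ≠ 0 ∧
          (∀ (t : T) (ht : (q t).pt ∈ U), (F.map ((q t).evalRingHom U ht)).eval (h t) = 0) ∧
          Set.InjOn h (q ⁻¹' {P₀}) := by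
  sorry

/-- **D — Deligne's global invariant cycle theorem (théorème de la partie fixe), as the EXISTING
route item stmt-HodgeConjecture-16363 BY NAME** (`Theses.LinearSystemTorelli.DeligneGlobalInvariantCycles`,
crux rank 4 of route `LinearSystemTorelli`; `Iff.rfl` with the tree's named fact
`deligne_globalInvariantCycles`, see `deligneGlobalInvariantCycles_iff`): for a smooth projective
family `f : 𝒳 ⟶ S` over a smooth quasi-projective complex base and an open immersion `i : 𝒳 ⟶ 𝒳̄`
into a smooth projective `𝒳̄`, every global flat section of `Rᵏ f_* ℂ` is, at each point, the
restriction of a class `i^* A`, `A ∈ Hᵏ(𝒳̄(ℂ); ℂ)`. Why it might fail: a 1971 theorem, so only its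
typing (`Continuous σ` on the étalé space = flat section; Ehresmann on the complex-points carriers);
real risk = size (Leray degeneration + Hodge II MHS + Cor. 3.2.17; two discharge attempts bounced,
residue = Voisin II Prop. 4.23 snc core). [DeligneHodgeII1971 Thm. 4.1.1; VoisinHodgeII2003
Prop. 4.23, Thm. 4.24; CharlesSchnell2014Notes Thm. 11.3.4; Deligne1968] -/
theorem stub_deligneGlobalInvariantCycles :
    Summit.HodgeConjecture.HodgeConjecture.Theses.LinearSystemTorelli.DeligneGlobalInvariantCycles := by
  sorry

/-- **N — smooth projective `ℚ̄`-schemes are defined over number fields (EGA IV₃ 8.8.2 (ii);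
classical).** For every smooth projective `ℚ̄`-scheme `W₀` of dimension `m` there are a number field
`K`, an embedding `ι : K →+* ℚ̄` and a `K`-scheme `W₁` with `W₀ ≅ W₁ ⊗_{K,ι} ℚ̄` over `ℚ̄`. Road:
`W₀ → Spec ℚ̄` is separated of finite type, so `Limits.exists_isPullback_specMap_subalgebra`
(`K = ℚ`, `B = ℚ̄`, PROVED) gives a model over a finitely generated `ℚ`-subalgebra `R ⊆ ℚ̄`; `R` is an
integral domain algebraic and finitely generated over `ℚ`, hence a field finite over `ℚ` — a number
field — and the cartesian square is the base-change isomorphism. Why it might fail: only by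
mis-typing (the isomorphism is asked in `SchemeOver ℚ̄`, i.e. OVER `ℚ̄`, which is what the cartesian
square gives); size M. [EGAIV3 Thm. 8.8.2 (ii); GortzWedhorn2020 Thm. 10.66, Prop. 10.75;
StacksProject Tag 01ZM; CharlesSchnell2014Notes §11.3.5] -/
theorem stub_numberFieldModel :
    ∀ ⦃m : ℕ⦄ (W₀ : SchemeOver (AlgebraicClosure ℚ)), IsSmoothProjective m W₀ →
      ∃ (K : Type) (_ : Field K) (_ : NumberField K) (ι : K →+* AlgebraicClosure ℚ)
        (W₁ : SchemeOver K), Nonempty (W₀ ≅ (baseChangeHom ι).obj W₁) := by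
  sorry

/-! ### Sorry-free links (tree theorems only) -/

/-- **T ⟹ global type stability at `ℚ̄`-generic points** (the tree's loop-shrinking theorem
`IsContinuationAlong.exists_loop_forall_base_pt_notMem_of_qbarFamily`, p136872: a continuation along
some loop at the `ℚ̄`-generic `s` is a continuation along a loop over `S₀ ∖ Z₀`). -/
theorem typeStabilityAtQbarGeneric_of_zariskiLocal
    (hT : ∀ (σ : AlgebraicClosure ℚ →+* ℂ) ⦃𝒳₀ S₀ : SchemeOver (AlgebraicClosure ℚ)⦄ (f₀ : 𝒳₀ ⟶ S₀)
      (n p : ℕ), IsQuasiProjectiveOver 𝒳₀ → IsQuasiProjectiveOver S₀ → IrreducibleSpace S₀.left →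
      AlgebraicGeometry.Smooth S₀.hom → IsSmoothProjectiveFamily ((baseChangeHom σ).map f₀) n →
      ∀ (s : ComplexPoints ((baseChangeHom σ).obj S₀)),
        closure {(baseChangeHomFst σ S₀).base s.pt} = (Set.univ : Set S₀.left) →
        ∀ (α : complexBetti (fiberOver ((baseChangeHom σ).map f₀) s) (2 * p)),
          IsRationalClass α → IsOfHodgeType n (fiberOver ((baseChangeHom σ).map f₀) s) (2 * p) p p α →
          ∃ Z₀ : Set S₀.left, IsClosed Z₀ ∧ Z₀ ≠ Set.univ ∧
            ∀ (γ : Path s s), (∀ u, (baseChangeHomFst σ S₀).base (γ u).pt ∉ Z₀) →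
              ∀ (β : complexBetti (fiberOver ((baseChangeHom σ).map f₀) s) (2 * p)),
                IsContinuationAlong γ α β →
                  IsOfHodgeType n (fiberOver ((baseChangeHom σ).map f₀) s) (2 * p) p p β) :
    ∀ (σ : AlgebraicClosure ℚ →+* ℂ) ⦃𝒳₀ S₀ : SchemeOver (AlgebraicClosure ℚ)⦄ (f₀ : 𝒳₀ ⟶ S₀)
      (n p : ℕ), IsQuasiProjectiveOver 𝒳₀ → IsQuasiProjectiveOver S₀ → IrreducibleSpace S₀.left →
      AlgebraicGeometry.Smooth S₀.hom → IsSmoothProjectiveFamily ((baseChangeHom σ).map f₀) n →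
      ∀ (s : ComplexPoints ((baseChangeHom σ).obj S₀)),
        closure {(baseChangeHomFst σ S₀).base s.pt} = (Set.univ : Set S₀.left) →
        ∀ (α : complexBetti (fiberOver ((baseChangeHom σ).map f₀) s) (2 * p)),
          IsRationalClass α → IsOfHodgeType n (fiberOver ((baseChangeHom σ).map f₀) s) (2 * p) p p α →
          ∀ (γ : Path s s) (β : complexBetti (fiberOver ((baseChangeHom σ).map f₀) s) (2 * p)),
            IsContinuationAlong γ α β →
              IsOfHodgeType n (fiberOver ((baseChangeHom σ).map f₀) s) (2 * p) p p β := by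
  intro σ 𝒳₀ S₀ f₀ n p h𝒳₀ hS₀ hirr hsm hf s hgen α hα hh γ β hγ
  obtain ⟨Z₀, hZ₀, hZ₀', H⟩ := hT σ f₀ n p h𝒳₀ hS₀ hirr hsm hf s hgen α hα hh
  haveI := hirr
  haveI := hsm
  obtain ⟨γ', hγ', hc⟩ :=
    IsContinuationAlong.exists_loop_forall_base_pt_notMem_of_qbarFamily σ f₀ (2 * p) hS₀ hf hZ₀ hZ₀'
      hgen hγ
  exact H γ' hγ' β hc

/-- **C ⟹ the named fact `FundamentalGroup.riemannExistence_qbarDescent_of_finiteIndex`**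
(Riemann's existence theorem with `ℚ̄`-descent of finite étale covers, finite-index form — the
antecedent of B): relative dimension `≤ 1` is the tree's
`algebraicSeparating_of_smoothOfRelativeDimension_le_one` (global, hence local on `U = ⊤`),
relative dimension `≥ 2` is C, and the tree's `…_of_locallyAlgebraicSeparating` (Theorems A/B′,
Zariski-local gluing, weak descent — all PROVED) concludes. -/
theorem riemannExistenceQbarDescent_of_locallyAlgebraicSeparatingDimGeTwo
    (hC : ∀ (n : ℕ) (S : SchemeOver ℂ), IsAffine S.left → SmoothOfRelativeDimension (n + 2) S.hom →
      IrreducibleSpace S.left →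
      ∀ (T : Type) [TopologicalSpace T] (q : T → ComplexPoints S) (_ : IsCoveringMap q)
        (_ : ∀ t, (q ⁻¹' {t}).Finite) (P₀ : ComplexPoints S),
        ∃ (U : S.left.Opens) (_ : IsAffineOpen U) (_ : P₀.pt ∈ U) (h : T → ℂ)
          (F : Polynomial Γ(S.left, U)),
          ContinuousOn h (q ⁻¹' {P | P.pt ∈ U}) ∧ F ≠ 0 ∧
          (∀ (t : T) (ht : (q t).pt ∈ U), (F.map ((q t).evalRingHom U ht)).eval (h t) = 0) ∧
          Set.InjOn h (q ⁻¹' {P₀})) :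
    Literature.AlgebraicGeometry.FundamentalGroup.riemannExistence_qbarDescent_of_finiteIndex := by
  refine Literature.AlgebraicGeometry.FundamentalGroup.riemannExistence_qbarDescent_of_finiteIndex_of_locallyAlgebraicSeparating
    fun S hS hsm hirr T _ q hq hfin P₀ ↦ ?_
  haveI := hS
  haveI := hsm
  haveI := hirr
  obtain ⟨n, hn⟩ := Motives.exists_smoothOfRelativeDimension_of_smooth S.hom
  rcases Nat.lt_or_ge n 2 with hlt | hge
  · obtain ⟨h, F, hh, hF, hroot, hinj⟩ :=
      Literature.AlgebraicGeometry.FundamentalGroup.algebraicSeparating_of_smoothOfRelativeDimension_le_one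
        (Nat.lt_succ_iff.mp hlt) S q hq hfin P₀
    exact ⟨⊤, isAffineOpen_top S.left, trivial, h, F, hh.continuousOn, hF, fun t _ ↦ hroot t, hinj⟩
  · obtain ⟨m, rfl⟩ := Nat.exists_eq_add_of_le' hge
    exact hC m S hS hn hirr T q hq hfin P₀

/-- The route decl of stmt-16363 IS the named fact `deligne_globalInvariantCycles` (the former
inlines `IsQuasiProjectiveOver S`, the latter's definition): `Iff.rfl`. -/
theorem deligneGlobalInvariantCycles_iff :
    Summit.HodgeConjecture.HodgeConjecture.Theses.LinearSystemTorelli.DeligneGlobalInvariantCycles ↔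
      deligne_globalInvariantCycles :=
  Iff.rfl

/-- **Transitivity of base change**: `(X_φ)_σ ≅ X_{σ ∘ φ}` for `φ : k →+* L`, `σ : L →+* M`
(Mathlib `Over.pullbackComp` and `Spec (σ ∘ φ) = Spec σ ≫ Spec φ`). -/
theorem nonempty_iso_baseChangeHom_comp {k L M : Type} [CommRing k] [CommRing L] [CommRing M]
    (φ : k →+* L) (σ : L →+* M) (X : SchemeOver k) :
    Nonempty ((baseChangeHom σ).obj ((baseChangeHom φ).obj X) ≅ (baseChangeHom (σ.comp φ)).obj X) := by
  have h : Spec.map (CommRingCat.ofHom (σ.comp φ)) =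
      Spec.map (CommRingCat.ofHom σ) ≫ Spec.map (CommRingCat.ofHom φ) := by
    rw [CommRingCat.ofHom_comp, Spec.map_comp]
  refine ⟨((CategoryTheory.Over.pullbackComp (Spec.map (CommRingCat.ofHom σ))
      (Spec.map (CommRingCat.ofHom φ))).app X).symm ≪≫ CategoryTheory.eqToIso ?_⟩
  change (CategoryTheory.Over.pullback _).obj X = (CategoryTheory.Over.pullback _).obj X
  rw [h]

/-! ### Composition: the stubs conclude the crux BY NAME -/

/-- **Assembly, implication form** (kernel-checked, no `sorry`): T → C → D → N → `Envelope`.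
Fix `σ : ℚ̄ →+* ℂ`; spread `X` out over `ℚ̄` (`e : X ≅ 𝒳_s`, `s` `ℚ̄`-generic — PROVED); the
transported class `(e⁻¹)^* c` is type-stable along loops (T + loop shrinking), hence has FINITE
monodromy orbit (Hodge–Riemann + lattice finiteness, PROVED); Voisin's mechanism B
(`Theorems.stub_dominantEnvelopeOfFiniteMonodromy`, PROVED) fed with C (Riemann existence) and D
(partie fixe) writes it as `ι^* c'` with `c'` rational `(p,p)` on a smooth projective `W₀ ⊗_σ ℂ`;
`W₀` is smooth projective over `ℚ̄` (`isSmoothProjective_of_baseChangeHom`, PROVED), so N gives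
`W₀ ≅ W₁ ⊗_{K,ι₀} ℚ̄` with `K` a number field, and `W₀ ⊗_σ ℂ ≅ W₁ ⊗_{K, σ ∘ ι₀} ℂ`. -/
theorem Envelope_of :
    (∀ (σ : AlgebraicClosure ℚ →+* ℂ) ⦃𝒳₀ S₀ : SchemeOver (AlgebraicClosure ℚ)⦄ (f₀ : 𝒳₀ ⟶ S₀)
      (n p : ℕ), IsQuasiProjectiveOver 𝒳₀ → IsQuasiProjectiveOver S₀ → IrreducibleSpace S₀.left →
      AlgebraicGeometry.Smooth S₀.hom → IsSmoothProjectiveFamily ((baseChangeHom σ).map f₀) n →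
      ∀ (s : ComplexPoints ((baseChangeHom σ).obj S₀)),
        closure {(baseChangeHomFst σ S₀).base s.pt} = (Set.univ : Set S₀.left) →
        ∀ (α : complexBetti (fiberOver ((baseChangeHom σ).map f₀) s) (2 * p)),
          IsRationalClass α → IsOfHodgeType n (fiberOver ((baseChangeHom σ).map f₀) s) (2 * p) p p α →
          ∃ Z₀ : Set S₀.left, IsClosed Z₀ ∧ Z₀ ≠ Set.univ ∧
            ∀ (γ : Path s s), (∀ u, (baseChangeHomFst σ S₀).base (γ u).pt ∉ Z₀) →
              ∀ (β : complexBetti (fiberOver ((baseChangeHom σ).map f₀) s) (2 * p)),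
                IsContinuationAlong γ α β →
                  IsOfHodgeType n (fiberOver ((baseChangeHom σ).map f₀) s) (2 * p) p p β) →
    (∀ (n : ℕ) (S : SchemeOver ℂ), IsAffine S.left → SmoothOfRelativeDimension (n + 2) S.hom →
      IrreducibleSpace S.left →
      ∀ (T : Type) [TopologicalSpace T] (q : T → ComplexPoints S) (_ : IsCoveringMap q)
        (_ : ∀ t, (q ⁻¹' {t}).Finite) (P₀ : ComplexPoints S),
        ∃ (U : S.left.Opens) (_ : IsAffineOpen U) (_ : P₀.pt ∈ U) (h : T → ℂ)
          (F : Polynomial Γ(S.left, U)),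
          ContinuousOn h (q ⁻¹' {P | P.pt ∈ U}) ∧ F ≠ 0 ∧
          (∀ (t : T) (ht : (q t).pt ∈ U), (F.map ((q t).evalRingHom U ht)).eval (h t) = 0) ∧
          Set.InjOn h (q ⁻¹' {P₀})) →
    Summit.HodgeConjecture.HodgeConjecture.Theses.LinearSystemTorelli.DeligneGlobalInvariantCycles →
    (∀ ⦃m : ℕ⦄ (W₀ : SchemeOver (AlgebraicClosure ℚ)), IsSmoothProjective m W₀ →
      ∃ (K : Type) (_ : Field K) (_ : NumberField K) (ι : K →+* AlgebraicClosure ℚ)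
        (W₁ : SchemeOver K), Nonempty (W₀ ≅ (baseChangeHom ι).obj W₁)) →
    Summit.HodgeConjecture.HodgeConjecture.Theses.QbarEnvelope.Envelope := by
  intro hT hC hD hN
  unfold Summit.HodgeConjecture.HodgeConjecture.Theses.QbarEnvelope.Envelope
  intro n X hX p c hc hh
  -- an embedding `σ : ℚ̄ →+* ℂ`
  obtain ⟨σ⟩ := exists_ringHom_algebraicClosure_rat_complex
  -- spread `X` out over `ℚ̄`: `e : X ≅ 𝒳_s`, `s` over the generic point of the smooth irreducible `S₀`
  obtain ⟨𝒳₀, S₀, f₀, s, h𝒳₀, hS₀, hirr, hsm, hf, hgen, ⟨e⟩⟩ :=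
    spreadingOut_smoothProjective_qbarFamily_holds σ hX
  -- finite monodromy orbit of the transported class `(e⁻¹)^* c` (type stability from T, then
  -- Hodge–Riemann + lattice finiteness — unconditional in the tree)
  have hfin := Theorems.linearSystemTorelli_finite_setOf_isContinuationAlong_of_forall_isOfHodgeType σ
    f₀ n p hf h𝒳₀ hS₀ hirr hsm s (complexBetti.map e.inv (2 * p) c) (hc.map _)
    (typeStabilityAtQbarGeneric_of_zariskiLocal hT σ f₀ n p h𝒳₀ hS₀ hirr hsm hf s hgen
      (complexBetti.map e.inv (2 * p) c) (hc.map _) (hh.map_of_iso e.symm))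
  -- Voisin's mechanism B (PROVED), fed with C (Riemann existence) and D (partie fixe)
  obtain ⟨m, W₀, ι, c', hW, -, hc', hh', hmap⟩ :=
    Theorems.stub_dominantEnvelopeOfFiniteMonodromy
      (riemannExistenceQbarDescent_of_locallyAlgebraicSeparatingDimGeTwo hC)
      (deligneGlobalInvariantCycles_iff.1 hD) σ f₀ n p h𝒳₀ hS₀ hirr hsm hf s hgen
      (complexBetti.map e.inv (2 * p) c) (hc.map _) (hh.map_of_iso e.symm) hfin
  -- `W₀` is smooth projective over `ℚ̄` (descent), so it has a number-field model (N)
  obtain ⟨K, hK, hKn, ι₀, W₁, ⟨e₁⟩⟩ := hN W₀ (isSmoothProjective_of_baseChangeHom σ W₀ hW)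
  obtain ⟨e₂⟩ := nonempty_iso_baseChangeHom_comp ι₀ σ W₁
  refine ⟨m, (baseChangeHom σ).obj W₀, e.hom ≫ ι, c', hW,
    ⟨K, hK, hKn, σ.comp ι₀, W₁, ⟨(baseChangeHom σ).mapIso e₁ ≪≫ e₂⟩⟩, hc', hh', ?_⟩
  rw [complexBetti.map_comp, ModuleCat.comp_apply, hmap]
  exact e.complexBetti_map_hom_map_inv (2 * p) c

/-- **The crux from its registered stubs, by name** (no `sorry` of its own; its closure is
conditional on the four `stub_*` placeholders until they are proved). -/
theorem Envelope_of_stubs : Summit.HodgeConjecture.HodgeConjecture.Theses.QbarEnvelope.Envelope :=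
  Envelope_of stub_typeStabilityAtQbarGenericZariskiLocal
    stub_locallyAlgebraicSeparatingSmoothAffineDimGeTwo stub_deligneGlobalInvariantCycles
    stub_numberFieldModel

end Summit.HodgeConjecture.HodgeConjecture.Cruxes.Envelope.Birth
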